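import Summits.KontsevichZagierPeriods.Zeta5Search.Barrier.ConeGammaLemmaFWindows

/-!
# ζ(5) search — BARRIER: WINDOWED LEMMA F from a general first wall, and the sawtooth integral on one cell

HONEST FRAMING (cell `pub-zeta5`): systematic search; no irrationality claim unless kernel-certified. MODEL objects under
Brown–Zudilin's (28)+(30) accounting ([BZ22] = arXiv:2210.03391; (28) observed, not proved): an explicit UPPER-BOUND
SCHEMA for BZ's MODEL saving rate `Φ = phi30` (window by window along the flow) and an elementary evaluation of the
sawtooth integral `∫ {w} w⁻² dw` on one integer cell; nothing here is about any `γ` of record, the cone's supremum (C2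
OPEN), S-E (CONJECTURED) or `ζ(5)`; no number or sentence of record moves; records in print UNMOVED. Prover P2 g24, sequel
(D′) to «LEMMA F IN THE KERNEL» (plan INBOX l.9199, ruling l.9201), file `ConeGammaLemmaFWindows` continued.

* **`phi30_le_of_sepBound_windows₀`** — `ConeGammaLemmaFWindows.phi30_le_of_sepBound_windows` with a GENERAL first
  end-point `U₀ > 0` subject to `U₀·h_k(a) ≤ 1` for all 28 forms (so `N_a ≡ 0` on `(0, U₀)`), instead of the normalisation
  `U₀ = 1`, `h_k ≤ 1`: in the memo's units (`s₀ = 1`, `t = s/s₀`) one may take `U₀ = u₀(t) = min(1, 1/(t₆+t₇))` directly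
  (cert-2 g32, SEP-MAJORANT §1 LEMMA F (ii)). Same conclusion:
  `Φ(a) ≤ Σ_{w<W} [c_w(1/U_w − 1/U_{w+1}) − Σ_m ε_{w,m} x_{w,m}(J(U_w,x) − J(U_{w+1},x))] + c_W/U_W − Σ_m ε_{W,m} x J(U_W,x)`,
  `J(R,x) = ∫_R^{Rx} {w}w⁻² dw`.
* `setIntegral_Ioi_eq_Ioi_of_eq_zero` — `∫_{(0,∞)} f = ∫_{(T,∞)} f` for `f ≡ 0` on `(0,T)`.
* `intervalIntegrable_fract_div_sq`; **`integral_fract_div_sq_cell`** — on one integer cell `n ≤ R ≤ S ≤ n + 1` (`R > 0`):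
  `∫_R^S {w} w⁻² dw = log(S/R) − n(1/R − 1/S)`; with `intervalIntegral.integral_add_adjacent_intervals` this evaluates
  every `J(R,x)` at rational `R, x` in logarithms of rationals and rationals (their kernel ENCLOSURE is a numerics item,
  not done here).
-/

noncomputable section

open Set MeasureTheory Filter
open scoped Topology

namespace Summit.KontsevichZagierPeriods.Zeta5Search.Barrier.ConeGamma

/-! ### The sawtooth integral on one cell -/

/-- `w ↦ {w}/w²` is interval integrable on `[R, S]` for `R, S > 0`. -/
theorem intervalIntegrable_fract_div_sq {R S : ℝ} (hR : 0 < R) (hS : 0 < S) :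
    IntervalIntegrable (fun w : ℝ => Int.fract w / w ^ 2) volume R S := by
  have hpos : ∀ w ∈ uIcc R S, 0 < w := fun w hw => (lt_min hR hS).trans_le hw.1
  have hinv : IntervalIntegrable (fun w : ℝ => w⁻¹) volume R S :=
    intervalIntegral.intervalIntegrable_inv (fun w hw => (hpos w hw).ne') continuousOn_id
  have hfl : IntervalIntegrable (fun w : ℝ => (⌊w⌋ : ℝ) / w ^ 2) volume R S :=
    (intervalIntegrable_floor_div_sq hR.le).symm.trans (intervalIntegrable_floor_div_sq hS.le)
  refine (hinv.sub hfl).congr fun w hw => ?_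
  have hw0 : w ≠ 0 := (hpos w (uIoc_subset_uIcc hw)).ne'
  have : (w⁻¹ : ℝ) - (⌊w⌋ : ℝ) / w ^ 2 = (w - ⌊w⌋) / w ^ 2 := by field_simp
  simpa only [Int.fract] using this

/-- **The sawtooth integral on one integer cell**: for an integer `n` and `0 < R ≤ S` with `n ≤ R`, `S ≤ n + 1`,
`∫_R^S {w} w⁻² dw = log(S/R) − n·(1/R − 1/S)`. -/
theorem integral_fract_div_sq_cell (n : ℤ) {R S : ℝ} (hR : 0 < R) (hRS : R ≤ S) (hnR : (n : ℝ) ≤ R)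
    (hSn : S ≤ n + 1) :
    ∫ w in R..S, Int.fract w / w ^ 2 = Real.log (S / R) - n * (1 / R - 1 / S) := by
  have hS : 0 < S := hR.trans_le hRS
  have h := intervalIntegral_floor_div_sq_eq_log_sub hR hS
  have hfl : ∫ w in R..S, (⌊w⌋ : ℝ) / w ^ 2 = n * (1 / R - 1 / S) := by
    rw [intervalIntegral.integral_of_le hRS, integral_Ioc_eq_integral_Ioo,
      setIntegral_congr_fun measurableSet_Ioo (g := fun w : ℝ => (n : ℝ) / w ^ 2) (fun w hw => by
        have hfloor : ⌊w⌋ = n := Int.floor_eq_iff.mpr ⟨hnR.trans hw.1.le, by linarith [hw.2]⟩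
        simp only [hfloor]),
      ← integral_Ioc_eq_integral_Ioo, ← intervalIntegral.integral_of_le hRS, integral_const_div_sq_window (n : ℝ) hR hRS]
  linarith

/-! ### WINDOWED LEMMA F from a general first wall -/

/-- `∫_{(0,∞)} f = ∫_{(T,∞)} f` for an integrable `f` vanishing on `(0,T)`, `T > 0`. -/
theorem setIntegral_Ioi_eq_Ioi_of_eq_zero {f : ℝ → ℝ} (hf : IntegrableOn f (Ioi 0)) {T : ℝ} (hT : 0 < T)
    (h0 : ∀ u ∈ Ioo (0 : ℝ) T, f u = 0) : ∫ u in Ioi (0 : ℝ), f u = ∫ u in Ioi T, f u := by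
  have hsplit : Ioi (0 : ℝ) = Ioo 0 T ∪ Ici T := (Ioo_union_Ici_eq_Ioi hT).symm
  have hdisj : Disjoint (Ioo (0 : ℝ) T) (Ici T) := by
    rw [Set.disjoint_left]
    intro u hu hu'
    exact absurd hu.2 (not_lt.mpr hu')
  rw [hsplit, setIntegral_union hdisj measurableSet_Ici (hf.mono_set Ioo_subset_Ioi_self)
    (hf.mono_set (Ici_subset_Ioi.mpr hT)), setIntegral_eq_zero_of_forall_eq_zero h0, zero_add,
    integral_Ici_eq_integral_Ioi]

/-- **WINDOWED LEMMA F from a general first wall `U₀`.** For `a` in the closed box and end-points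
`0 < U₀ ≤ U₁ ≤ ⋯ ≤ U_W` with `U₀·h_k(a) ≤ 1` for all 28 forms (so `N_a ≡ 0` on `(0, U₀)`), and on each window
(`(U_w, U_{w+1})` for `w < W`, `(U_W, ∞)`) an oriented separable bound `N_a(u) ≤ c_w + Σ_{m∈M_w} ε_{w,m}{u x_{w,m}}`
(`0 ≤ x_{w,m}`, `Σ_m ε_{w,m} x_{w,m} = 0`) valid off a countable set `S`:
`Φ(a) ≤ Σ_{w<W} [c_w(1/U_w − 1/U_{w+1}) − Σ_m ε_{w,m} x_{w,m} (J(U_w,x_{w,m}) − J(U_{w+1},x_{w,m}))]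
 + c_W/U_W − Σ_m ε_{W,m} x_{W,m} J(U_W, x_{W,m})`, `J(R,x) = ∫_R^{Rx} {w} w⁻² dw`. -/
theorem phi30_le_of_sepBound_windows₀ {a : Dir} (ha : BZBox a)
    {ι : Type*} (W : ℕ) (U : ℕ → ℝ) (hU0 : 0 < U 0) (hh : ∀ k : Fin 28, U 0 * h28 a k ≤ 1)
    (hU : ∀ w < W, U w ≤ U (w + 1))
    (M : ℕ → Finset ι) (ε x : ℕ → ι → ℝ) (c : ℕ → ℝ)
    (hx0 : ∀ w ≤ W, ∀ m ∈ M w, 0 ≤ x w m)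
    (hlin : ∀ w ≤ W, ∑ m ∈ M w, ε w m * x w m = 0) {S : Set ℝ} (hS : S.Countable)
    (hN : ∀ w < W, ∀ u ∈ Ioo (U w) (U (w + 1)), u ∉ S →
      (savingN a u : ℝ) ≤ c w + ∑ m ∈ M w, ε w m * Int.fract (u * x w m))
    (hNW : ∀ u ∈ Ioi (U W), u ∉ S → (savingN a u : ℝ) ≤ c W + ∑ m ∈ M W, ε W m * Int.fract (u * x W m)) :
    phi30 a ≤
      (∑ w ∈ Finset.range W, (c w * (1 / U w - 1 / U (w + 1))
        - ∑ m ∈ M w, ε w m * (x w m * ((∫ v in (U w)..(U w * x w m), Int.fract v / v ^ 2)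
            - ∫ v in (U (w + 1))..(U (w + 1) * x w m), Int.fract v / v ^ 2))))
      + (c W / U W - ∑ m ∈ M W, ε W m * (x W m * ∫ v in (U W)..(U W * x W m), Int.fract v / v ^ 2)) := by
  -- end-points are `≥ U₀ > 0`
  have hU1 : ∀ w ≤ W, U 0 ≤ U w := by
    intro w hw
    induction w with
    | zero => exact le_rfl
    | succ w ih => exact (ih (Nat.le_of_succ_le hw)).trans (hU w (Nat.lt_of_succ_le hw))
  have hUpos : ∀ w ≤ W, 0 < U w := fun w hw => hU0.trans_le (hU1 w hw)
  set f : ℝ → ℝ := fun u => (savingN a u : ℝ) / u ^ 2 with hf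
  have hfint : IntegrableOn f (Ioi 0) := integrableOn_savingN_div_sq ha
  set D : ℕ → ι → ℝ → ℝ := fun w m u => ((⌊u * x w m⌋ : ℝ) - x w m * ⌊u⌋) / u ^ 2 with hD
  set g : ℕ → ℝ → ℝ := fun w u => c w / u ^ 2 - ∑ m ∈ M w, ε w m * D w m u with hg
  have hpt : ∀ w ≤ W, ∀ u, 0 < u → u ∉ S →
      ((savingN a u : ℝ) ≤ c w + ∑ m ∈ M w, ε w m * Int.fract (u * x w m)) → f u ≤ g w u := by
    intro w hw u hu0 _ hb
    have h := div_le_div_of_nonneg_right hb (sq_nonneg u)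
    rw [sepBound_eq_defect (M w) (ε w) (x w) (c w) (hlin w hw) u, sub_div, Finset.sum_div] at h
    simpa only [hf, hg, hD, mul_div_assoc] using h
  -- `Φ = ∫_{(U₀,∞)} f = ∫_{U₀}^{U_W} f + ∫_{(U_W,∞)} f`
  have hphi : phi30 a = ∫ u in Ioi (U 0), f u := by
    unfold phi30
    refine setIntegral_Ioi_eq_Ioi_of_eq_zero hfint hU0 fun u hu => ?_
    have hk : ∀ k : Fin 28, u * h28 a k < 1 := fun k => by
      rcases (h28_nonneg_of_BZBox ha k).eq_or_lt with h | h
      · rw [← h, mul_zero]; exact zero_lt_one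
      · exact (mul_lt_mul_of_pos_right hu.2 h).trans_le (hh k)
    show (savingN a u : ℝ) / u ^ 2 = 0
    rw [savingN_eq_zero_of_forall_lt_one ha hu.1.le hk, Int.cast_zero, zero_div]
  have hUW := hU1 W le_rfl
  have hsplit : ∫ u in Ioi (U 0), f u = (∫ u in (U 0)..U W, f u) + ∫ u in Ioi (U W), f u := by
    rw [← Ioc_union_Ioi_eq_Ioi hUW, setIntegral_union (Ioc_disjoint_Ioi le_rfl) measurableSet_Ioi
      (hfint.mono_set (Ioc_subset_Ioi_self.trans (Ioi_subset_Ioi hU0.le)))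
      (hfint.mono_set (Ioi_subset_Ioi (hU0.le.trans hUW))), intervalIntegral.integral_of_le hUW]
  have hfwin : ∀ w < W, IntervalIntegrable f volume (U w) (U (w + 1)) := by
    intro w hw
    rw [intervalIntegrable_iff_integrableOn_Ioc_of_le (hU w hw)]
    exact hfint.mono_set (Ioc_subset_Ioi_self.trans (Ioi_subset_Ioi (hUpos w hw.le).le))
  have hDwin : ∀ w ≤ W, ∀ m ∈ M w, ∀ {A B : ℝ}, 0 < A → A ≤ B → IntervalIntegrable (D w m) volume A B := by
    intro w hw m hm A B hA hAB
    rw [intervalIntegrable_iff_integrableOn_Ioc_of_le hAB]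
    exact (integrableOn_floorDefect (hx0 w hw m hm)).mono_set (Ioc_subset_Ioi_self.trans (Ioi_subset_Ioi hA.le))
  have hcwin : ∀ w < W, IntervalIntegrable (fun u : ℝ => c w / u ^ 2) volume (U w) (U (w + 1)) := by
    intro w hw
    rw [intervalIntegrable_iff_integrableOn_Ioc_of_le (hU w hw)]
    exact (integrableOn_const_div_sq_Ioi (c w) (hUpos w hw.le)).mono_set Ioc_subset_Ioi_self
  have hswin : ∀ w < W, IntervalIntegrable (fun u : ℝ => ∑ m ∈ M w, ε w m * D w m u) volume (U w) (U (w + 1)) := by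
    intro w hw
    rw [intervalIntegrable_iff_integrableOn_Ioc_of_le (hU w hw)]
    exact integrable_finsetSum (M w) fun m hm => (((integrableOn_floorDefect (hx0 w hw.le m hm)).mono_set
      (Ioc_subset_Ioi_self.trans (Ioi_subset_Ioi (hUpos w hw.le).le))).const_mul (ε w m))
  have hwin : ∀ w < W, ∫ u in (U w)..(U (w + 1)), f u ≤
      c w * (1 / U w - 1 / U (w + 1)) - ∑ m ∈ M w, ε w m * (x w m *
        ((∫ v in (U w)..(U w * x w m), Int.fract v / v ^ 2)
          - ∫ v in (U (w + 1))..(U (w + 1) * x w m), Int.fract v / v ^ 2)) := by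
    intro w hw
    have hle : ∫ u in (U w)..(U (w + 1)), f u ≤ ∫ u in (U w)..(U (w + 1)), g w u := by
      refine intervalIntegral.integral_mono_ae_restrict (hU w hw) (hfwin w hw) ((hcwin w hw).sub (hswin w hw)) ?_
      refine ae_le_of_countable measurableSet_Icc (hS.union ((Set.countable_singleton (U w)).union
        (Set.countable_singleton (U (w + 1))))) fun u hu hus => ?_
      simp only [Set.mem_union, Set.mem_singleton_iff, not_or] at hus
      have hu' : u ∈ Ioo (U w) (U (w + 1)) :=
        ⟨lt_of_le_of_ne hu.1 (Ne.symm hus.2.1), lt_of_le_of_ne hu.2 hus.2.2⟩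
      exact hpt w hw.le u ((hUpos w hw.le).trans hu'.1) hus.1 (hN w hw u hu' hus.1)
    refine hle.trans (le_of_eq ?_)
    simp only [hg]
    rw [intervalIntegral.integral_sub (hcwin w hw) (hswin w hw),
      integral_const_div_sq_window (c w) (hUpos w hw.le) (hU w hw),
      intervalIntegral.integral_finsetSum fun m hm => (hDwin w hw.le m hm (hUpos w hw.le) (hU w hw)).const_mul (ε w m)]
    congr 1
    refine Finset.sum_congr rfl fun m hm => ?_
    rw [intervalIntegral.integral_const_mul, hD]
    simp only
    rw [integral_floorDefect_window (hx0 w hw.le m hm) (hUpos w hw.le) (hU w hw)]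
  have hlast : ∫ u in Ioi (U W), f u ≤
      c W / U W - ∑ m ∈ M W, ε W m * (x W m * ∫ v in (U W)..(U W * x W m), Int.fract v / v ^ 2) := by
    have hUW0 := hUpos W le_rfl
    have hcI := integrableOn_const_div_sq_Ioi (c W) hUW0
    have hDI : ∀ m ∈ M W, IntegrableOn (D W m) (Ioi (U W)) := fun m hm =>
      (integrableOn_floorDefect (hx0 W le_rfl m hm)).mono_set (Ioi_subset_Ioi hUW0.le)
    have hsI : IntegrableOn (fun u : ℝ => ∑ m ∈ M W, ε W m * D W m u) (Ioi (U W)) :=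
      integrable_finsetSum (M W) fun m hm => (hDI m hm).const_mul (ε W m)
    have hle : ∫ u in Ioi (U W), f u ≤ ∫ u in Ioi (U W), g W u := by
      refine setIntegral_mono_ae_restrict (hfint.mono_set (Ioi_subset_Ioi hUW0.le)) (hcI.sub hsI) ?_
      refine ae_le_of_countable measurableSet_Ioi hS fun u hu hus => ?_
      exact hpt W le_rfl u (hUW0.trans hu) hus (hNW u hu hus)
    refine hle.trans (le_of_eq ?_)
    simp only [hg]
    rw [integral_sub hcI hsI, integral_const_div_sq_Ioi (c W) hUW0,
      integral_finsetSum (M W) fun m hm => (hDI m hm).const_mul (ε W m)]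
    congr 1
    refine Finset.sum_congr rfl fun m hm => ?_
    rw [integral_const_mul, hD]
    simp only
    rw [integral_floorDefect_tail (hx0 W le_rfl m hm) hUW0]
  have hadj := intervalIntegral.sum_integral_adjacent_intervals hfwin
  rw [hphi, hsplit, ← hadj]
  have hsum := Finset.sum_le_sum fun w hw => hwin w (Finset.mem_range.mp hw)
  linarith

end Summit.KontsevichZagierPeriods.Zeta5Search.Barrier.ConeGamma

end
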